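import Mathlib.NumberTheory.LSeries.RiemannZeta
import Mathlib.NumberTheory.ArithmeticFunction.Moebius
import Mathlib.MeasureTheory.Integral.IntervalIntegral.Basic
import Mathlib.Analysis.SpecialFunctions.Pow.Complex
import Literature.NumberTheory.LFunctions.GeneralizedRH
import HarnessLib

/-!
# Barrier: limitations of mollifier / Levinson-method arguments (Radziwiłł 2012; Bettin–Gonek 2017)

Barrier catalogue `Literature/Barriers/RiemannHypothesis/` (D-0021), entry `MollifierLimitations`
(namespace `Literature.Barriers.RiemannHypothesis`; the catalogued declaration is `MollifierLimitations`, the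
conjunction of `Radziwill2012_thm1` and `BettinGonek2017_thm1`).

## The technique

Levinson's method bounds from below the proportion `κ` of zeros of `ζ` on the critical line by
bounding from above a *mollified second moment*
`I_N(T₁,T₂) = ∫_{T₁}^{T₂} |M_N(½+it)|² |ζ(½+it)|² dt`, `M_N(s) = ∑_{n ≤ N} μ(n) n^{-s} (1 − log n / log N)`
(Bettin–Gonek 2017, §1), or, in Radziwiłł's normalisation, by making
`𝓘(M) = T⁻¹ ∫_T^{2T} |1 − ζ(½+it) M(½+it)|² dt` small for a Dirichlet-polynomial mollifier
`M_θ(s) = ∑_{n ≤ T^θ} a(n) n^{-s}`, `a(1) = 1`, `a(n) ≪ n^ε` (Radziwiłł 2012, (1)). Levinson's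
asymptotic `I_{T^θ}(0,T)/T → 1 + 1/θ` (`θ < 1/2`) gives `κ > 1/3`; Conrey's extension to
`θ < 4/7` gives `κ > 2/5` (Bettin–Gonek 2017, §1; `𝓘(𝓛_θ) ∼ 1/θ` for `θ < 4/7`, Radziwiłł 2012, §1).

## The obstruction (what this file vendors)

* `Radziwill2012_thm1` — **Theorem 1** of Radziwiłł 2012 (unconditional): there is an absolute
  `c > 0` with `𝓘(M_θ) ≥ c/θ` for every `θ > 0`, all large `T` and every admissible `M_θ` of length
  `T^θ`, however the coefficients are chosen. Consequence printed in
  Bettin–Gonek 2017, §1: "Levinson's method can give `κ = 1` only if it is used with mollifiers of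
  length `T^θ`, where `θ` is arbitrarily large."
* `BettinGonek2017_thm1`, `BettinGonek2017_thm2` — **Theorems 1 and 2** of Bettin–Gonek 2017: the
  mean-value input that long mollifiers would require (even the upper bound
  `I_N(0,T) ≪_ε T^{1+ε}` for `2 ≤ N ≤ T^θ`) already implies the quasi-Riemann hypothesis
  `ζ(s) ≠ 0` for `Re s > 1/2 + 1/(2θ)` (resp. `> 1/2 + 2/θ` for the dyadic moment `I_N(T,2T)`);
  for `θ` arbitrarily large it implies RH (`BettinGonek2017_thm1.riemannHypothesis`, proved here from
  the fact and `Literature.NumberTheory.LFunctions.quasiRiemannHypothesis_one_half_iff_holds`). So Farmer's "θ = ∞ conjecture",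
  the published way to push Levinson's method to `κ = 1`, is itself at least as strong as RH.
* Also printed (Radziwiłł 2012): **Proposition B** (Soundararajan) `𝓘(M_θ) ≥ 1/θ + o(1)` for
  `θ < 1/2` (so `c = 1` there), and **Theorem 2** (on RH and the Pair Correlation Conjecture)
  `𝓘(M_θ) ≥ (1 + o(1))/(0.5 + θ)`; recorded informally only.

## References

* [Radziwill2012] M. Radziwiłł, *Limitations to mollifying ζ(s)*, arXiv:1207.6583 (2012),
  unpublished manuscript (read: §1, Thm. 1, Prop. B, Thm. 2, Thm. 3, eq. (1)).
* [BettinGonek2017] S. Bettin, S. M. Gonek, *The θ = ∞ conjecture implies the Riemann hypothesis*,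
  Mathematika 63 (2017), 29–33; arXiv:1604.02740 (read: §1, Thm. 1, Thm. 2 and the remarks after).
* [Farmer1993] D. W. Farmer, *Long mollifiers of the Riemann zeta-function*, Mathematika 40 (1993),
  71–87 (the θ = ∞ conjecture and `θ = ∞ ⟹ κ = 1`; cited through [BettinGonek2017, §1] — not held,
  acquisition request acq-00336).
* [Levinson1974] N. Levinson, Adv. Math. 13 (1974), 383–436; [Conrey1989] J. B. Conrey, J. reine
  angew. Math. 399 (1989), 1–26 (`θ < 4/7`, `κ > 2/5`).
* [Titchmarsh1986] E. C. Titchmarsh, *The Theory of the Riemann Zeta-Function*, 2nd ed. revised by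
  D. R. Heath-Brown (1986), §10.28 (Levinson's method: Littlewood's formula and the concavity step
  (10.28.10)–(10.28.11)); cited in the BARRIER block, scope_caveats (iii) (audit 2026-08-14).

## Design notes

* `𝓘`, `I_N` and `M_N` are one-line glue over Mathlib (`riemannZeta`, `ArithmeticFunction.moebius`,
  interval integrals), written exactly as printed; points on the critical line are `1/2 + t I`.
* "`a(n) ≪ n^ε`" is read as: for every `ε > 0`, `|a(n)| ≤ C(ε) n^ε` for a fixed family of implied
  constants `C : ℝ → ℝ`; "for all `T` large enough" may depend on `θ` and on `C`. The constant `c` is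
  absolute as printed (§1: "there is an absolute constant `c > 0` such that `𝓘(M_θ) ≥ c/θ` for all
  `θ > 0` and all `M_θ` as in (1)"), so the quantifier order is `∃ c, ∀ θ, ∀ C, ∃ T₀, ∀ T ≥ T₀, ∀ a`.
* Bettin–Gonek's proof of Theorem 1 integrates `I_y` over real `y ∈ [1, x]`, while the printed
  hypothesis (vendored verbatim) ranges over integers `2 ≤ N ≤ T^θ`; barrier auditors should read the
  hypothesis in the printed, integer form.
* "`I_N(0,T) ≪_ε T^{1+ε}` for `2 ≤ N ≤ T^θ`" is read with the bound required for all `T ≥ 2`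
  (equivalent to "all large `T`" after enlarging the constant, both sides being bounded for bounded
  `T`).
-/

noncomputable section

open Complex MeasureTheory
open scoped ArithmeticFunction.Moebius

namespace Literature.Barriers.RiemannHypothesis

/-! ## Glue: mollifiers and mollified moments -/

/-- A Dirichlet polynomial of length `N` with coefficients `a`, `M(s) = ∑_{1 ≤ n ≤ N} a(n) n^{-s}`,
used as a mollifier (Radziwiłł 2012, eq. (1)); the mollifier conditions `a(1) = 1`, `a(n) ≪ n^ε`,
`N = T^θ` are imposed in the fact `Radziwill2012_thm1`, not here. `dirichletMollifier a 0 s = 0`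
(empty sum). [cite: Radziwill2012, (1)] -/
def dirichletMollifier (a : ℕ → ℂ) (N : ℕ) (s : ℂ) : ℂ :=
  ∑ n ∈ Finset.Icc 1 N, a n * (n : ℂ) ^ (-s)

/-- Radziwiłł's mollification defect
`𝓘(M) = T⁻¹ ∫_T^{2T} |1 − ζ(½ + it) M(½ + it)|² dt` (Radziwiłł 2012, §1). [cite: Radziwill2012, §1] -/
def mollificationDefect (M : ℂ → ℂ) (T : ℝ) : ℝ :=
  T⁻¹ * ∫ t in T..(2 * T), ‖1 - riemannZeta (1 / 2 + t * I) * M (1 / 2 + t * I)‖ ^ 2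

/-- The Levinson–Conrey mollifier `M_N(s) = ∑_{n ≤ N} μ(n) n^{-s} (1 − log n / log N)`, `N ≥ 2`
(Bettin–Gonek 2017, §1). [cite: BettinGonek2017, §1] -/
def levinsonMollifier (N : ℕ) (s : ℂ) : ℂ :=
  ∑ n ∈ Finset.Icc 1 N, ((μ n : ℤ) : ℂ) * ((1 - Real.log n / Real.log N : ℝ) : ℂ) * (n : ℂ) ^ (-s)

/-- The mollified second moment `I_N(T₁,T₂) = ∫_{T₁}^{T₂} |M_N(½+it)|² |ζ(½+it)|² dt`
(Bettin–Gonek 2017, §1). [cite: BettinGonek2017, §1] -/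
def mollifiedSecondMoment (N : ℕ) (T₁ T₂ : ℝ) : ℝ :=
  ∫ t in T₁..T₂, ‖levinsonMollifier N (1 / 2 + t * I)‖ ^ 2 * ‖riemannZeta (1 / 2 + t * I)‖ ^ 2

/-! ## The barrier facts -/

/-- **Radziwiłł 2012, Theorem 1: mollifiers of any fixed length cannot make the mollification
defect small.** "Let `θ > 0` be given. There is an absolute constant `c > 0` such that
for all `T` large enough, and all `M_θ` as in (1) [`M_θ(s) = ∑_{n ≤ T^θ} a(n) n^{-s}`, `a(n) ≪ n^ε`,
`a(1) = 1`], `𝓘(M_θ) = T⁻¹ ∫_T^{2T} |1 − ζ(½+it) M_θ(½+it)|² dt ≥ c/θ`."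
[cite: Radziwill2012, Theorem 1] -/
def Radziwill2012_thm1 : Prop :=
  ∃ c : ℝ, 0 < c ∧ ∀ θ : ℝ, 0 < θ →
    ∀ C : ℝ → ℝ, ∃ T₀ : ℝ, ∀ T : ℝ, T₀ ≤ T →
      ∀ a : ℕ → ℂ, a 1 = 1 →
        (∀ ε : ℝ, 0 < ε → ∀ n : ℕ, 1 ≤ n → ‖a n‖ ≤ C ε * (n : ℝ) ^ ε) →
          c / θ ≤ mollificationDefect (dirichletMollifier a ⌊T ^ θ⌋₊) T

/-- **Bettin–Gonek 2017, Theorem 1: the mean-value input of long mollifiers is a quasi-Riemann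
hypothesis.** "Let `θ > 0` and assume that for every `ε > 0` we have
`I_N(0,T) ≪_ε T^{1+ε}` for `N` in the range `2 ≤ N ≤ T^θ`. Then `ζ(s)` has no zeros in the
half-plane `Re s > 1/2 + 1/(2θ)`. In particular, if this holds with `θ` arbitrarily large, then the
Riemann hypothesis is true."
[cite: BettinGonek2017, Theorem 1] -/
def BettinGonek2017_thm1 : Prop :=
  ∀ θ : ℝ, 0 < θ →
    (∀ ε : ℝ, 0 < ε → ∃ C : ℝ, ∀ T : ℝ, 2 ≤ T → ∀ N : ℕ, 2 ≤ N → (N : ℝ) ≤ T ^ θ →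
        mollifiedSecondMoment N 0 T ≤ C * T ^ (1 + ε)) →
      ∀ s : ℂ, 1 / 2 + 1 / (2 * θ) < s.re → riemannZeta s ≠ 0

/-- **Bettin–Gonek 2017, Theorem 2** (dyadic version). "Let `θ > 0` and assume that for every
`ε > 0` we have `I_N(T,2T) ≪_ε T^{1+ε}` for `N` in the range `2 ≤ N ≤ T^θ`. Then `ζ(s)` has no zeros
in the half-plane `Re s > 1/2 + 2/θ`."
[cite: BettinGonek2017, Theorem 2] -/
def BettinGonek2017_thm2 : Prop :=
  ∀ θ : ℝ, 0 < θ →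
    (∀ ε : ℝ, 0 < ε → ∃ C : ℝ, ∀ T : ℝ, 2 ≤ T → ∀ N : ℕ, 2 ≤ N → (N : ℝ) ≤ T ^ θ →
        mollifiedSecondMoment N T (2 * T) ≤ C * T ^ (1 + ε)) →
      ∀ s : ℂ, 1 / 2 + 2 / θ < s.re → riemannZeta s ≠ 0

/-- The printed corollary of Theorem 1: if the moment bound holds for arbitrarily large `θ`, the
Riemann hypothesis follows (a zero-free half-plane `Re s > 1/2 + 1/(2θ)` for every `θ` is
`Literature.QuasiRiemannHypothesis (1/2)`, which is RH by `Literature.NumberTheory.LFunctions.quasiRiemannHypothesis_one_half_iff_holds`).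
[cite: BettinGonek2017, Theorem 1] -/
theorem BettinGonek2017_thm1.riemannHypothesis (h : BettinGonek2017_thm1)
    (hyp : ∀ θ : ℝ, 0 < θ → ∀ ε : ℝ, 0 < ε → ∃ C : ℝ, ∀ T : ℝ, 2 ≤ T → ∀ N : ℕ, 2 ≤ N →
      (N : ℝ) ≤ T ^ θ → mollifiedSecondMoment N 0 T ≤ C * T ^ (1 + ε)) :
    RiemannHypothesis := by
  refine Literature.NumberTheory.LFunctions.quasiRiemannHypothesis_one_half_iff_holds.1 fun s hs h0 _ ↦ ?_
  -- choose `θ` with `1/2 + 1/(2θ) < re s`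
  have hpos : 0 < s.re - 1 / 2 := by linarith
  set θ : ℝ := 1 / (s.re - 1 / 2) with hθ
  have hθpos : 0 < θ := by positivity
  have key : 1 / 2 + 1 / (2 * θ) < s.re := by
    have : 1 / (2 * θ) = (s.re - 1 / 2) / 2 := by
      rw [hθ]; field_simp
    rw [this]; linarith
  exact h θ hθpos (hyp θ hθpos) s key hs


/-- The printed corollary of Theorem 2 ("In particular, if `I_N(T,2T) ≪_ε T^{1+ε}` for
`2 ≤ N ≤ T^θ` with `θ` arbitrarily large, then the Riemann hypothesis is true"): a zero-free
half-plane `Re s > 1/2 + 2/θ` for every `θ` is `Literature.QuasiRiemannHypothesis (1/2)`.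
[cite: BettinGonek2017, Theorem 2] -/
theorem BettinGonek2017_thm2.riemannHypothesis (h : BettinGonek2017_thm2)
    (hyp : ∀ θ : ℝ, 0 < θ → ∀ ε : ℝ, 0 < ε → ∃ C : ℝ, ∀ T : ℝ, 2 ≤ T → ∀ N : ℕ, 2 ≤ N →
      (N : ℝ) ≤ T ^ θ → mollifiedSecondMoment N T (2 * T) ≤ C * T ^ (1 + ε)) :
    RiemannHypothesis := by
  refine Literature.NumberTheory.LFunctions.quasiRiemannHypothesis_one_half_iff_holds.1 fun s hs h0 _ ↦ ?_
  have hpos : 0 < s.re - 1 / 2 := by linarith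
  set θ : ℝ := 4 / (s.re - 1 / 2) with hθ
  have hθpos : 0 < θ := by positivity
  have key : 1 / 2 + 2 / θ < s.re := by
    have : 2 / θ = (s.re - 1 / 2) / 2 := by
      rw [hθ]; field_simp; ring
    rw [this]; linarith
  exact h θ hθpos (hyp θ hθpos) s key hs

/-! ## The barrier -/

/-- **Barrier `MollifierLimitations`.** What mollification of `ζ` on the critical line can deliver
is capped at every fixed mollifier length, and removing the cap presupposes RH: (i) unconditionally
`𝓘(M_θ) ≥ c/θ` for every Dirichlet-polynomial mollifier of length `T^θ` (`Radziwill2012_thm1`), so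
that "Levinson's method can give `κ = 1` only if it is used with mollifiers of length `T^θ`, where `θ`
is arbitrarily large" (Bettin–Gonek 2017, §1); (ii) the mean-value input such long mollifiers require
— Farmer's θ = ∞ conjecture, even in the weak form `I_N(0,T) ≪_ε T^{1+ε}` for `2 ≤ N ≤ T^θ` — already
implies `ζ(s) ≠ 0` for `Re s > 1/2 + 1/(2θ)`, hence RH when `θ` is unbounded (`BettinGonek2017_thm1`,
`BettinGonek2017_thm1.riemannHypothesis`).

BARRIER (structured block, D-0021):
- technique_class: mollifier (one-piece Dirichlet polynomial `Σ_{n ≤ T^θ} a(n) n^{-s}`, `a(1) = 1`, `a(n) ≪ n^ε`, mollifying `ζ` itself on `σ = ½`) mollified-second-moment L2-defect long-mollifiers theta-infinity; Levinson-method only heuristically (scope_caveats (iii), audit 2026-08-14)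
- blocks: (i) `𝓘(M_θ) → 0`, i.e. `ζ M_θ → 1` in `L²[T, 2T]` on `σ = ½` — the L²-form of "perfect mollification" — for one-piece Dirichlet-polynomial mollifiers of any bounded length `θ` with `a(1) = 1`, `a(n) ≪ n^ε` [cite: Radziwill2012, Thm. 1]; the transfer to "`κ = 1` by Levinson's method needs `θ` arbitrarily large" is the informal sentence of [cite: BettinGonek2017, §1], not a theorem (scope_caveats (iii)); (ii) RiemannHypothesis and `κ = 1` via the Levinson–Conrey mollifiers `M_N` of unbounded length (θ = ∞ conjecture [cite: Farmer1993]), whose required moment bound, uniformly in `2 ≤ N ≤ T^θ`, is itself a quasi-Riemann hypothesis [cite: BettinGonek2017, Thm. 1]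
- because: `𝓘(M_θ) = T⁻¹∫_T^{2T}|1 − ζM_θ|² ≥ c/θ` for all coefficients `a(n) ≪ n^ε`, `a(1) = 1` (Sobolev-type lower bound near well-spaced critical zeros, of which a positive proportion exist) [cite: Radziwill2012, Thm. 1 and Prop. A]; and a zero `ρ₀` with `Re ρ₀ = β₀ > 1/2` forces `I_N(0,T) ≫ N^{2β₀−1}/log² N`, incompatible with `I_N(0,T) ≪ T^{1+ε}` for `N = T^θ` once `θ(2β₀ − 1) > 1` [cite: BettinGonek2017, Thm. 1 and the displays after Thm. 2]
- evasions_known: longer admissible mollifiers via Kloosterman-sum estimates (Conrey 1989: `θ < 4/7`, `κ > 2/5`, as reported in [cite: BettinGonek2017, §1] and [cite: Radziwill2012, §1]; present asymptotic frontier for the twisted second moment: `θ < 17/33` for arbitrary `a(n) ≪ n^ε`, Bettin–Chandee–Radziwiłł, J. reine angew. Math. 729 (2017) = arXiv:1411.7764, Thm. 1; `6/11` for Feng-type coefficients, Pratt–Robles, arXiv:1706.04593, §1.1) — consistent with (i) (`𝓘(𝓛_θ) ∼ 1/θ`), not around it; OUTSIDE hypothesis (1) of [cite: Radziwill2012, Thm.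 1] and hence not covered by (i): the choice of the linear combination `Q(−L⁻¹ d/ds)ζ` that Levinson's method actually mollifies (optimal `Q` gives `κ > 0` at every `θ > 0`: Conrey–Farmer–Kwan–Lin–Turnage-Butterbaugh, arXiv:2508.11108, §1), the abscissa `σ = ½ − R/log T < ½`, and two-piece mollifiers with a `χ(s + ½ − σ₀) Σ μ₂(h) h^{-s} k^{-(1-s)}` piece (Bui–Conrey–Young; "analogues for double-mollifiers" are asserted without proof, [cite: Radziwill2012, p. 4]); the dyadic moment `I_N(T,2T)` gives only `Re s > 1/2 + 2/θ` and is "in a certain sense best possible" (`BettinGonek2017_thm2`) [cite: BettinGonek2017, Thm. 2]; no published way to make `𝓘(M_θ) → 0` at fixed `θ`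
- status: established ([cite: BettinGonek2017, Thm. 1] refereed; [cite: Radziwill2012, Thm. 1] an arXiv manuscript, unpublished, with `c = 1` for `θ < 1/2` by Prop. B there)
- scope_caveats: (i) bounds Radziwiłł's defect `𝓘`, not Levinson's proportion `κ` directly; the transfer to `κ` is the sentence quoted from [cite: BettinGonek2017, §1]; (ii) is vendored with the printed integer range `2 ≤ N ≤ T^θ`, whereas the proof in [cite: BettinGonek2017, §2] averages `I_y` over real `y` — read the hypothesis in the printed form; (iii) (audit 2026-08-14) (i) is NOT a theorem about Levinson's method: Levinson's bound `N ≤ (log T₂/(2πa)) ∫ log|Gψ(u+it)| dt + O(log T₂)`, `u = ½ − a/log T₂`, `G = ζ + ζ'/F`, consumes an upper bound for a Littlewood log-integral left of the line and reaches the mollified second moment only through concavity of `log` [cite: Titchmarsh1986, §10.28], whereas Thm. 1 is an L²-defect floor for `ζ·M` at `σ = ½` exactly (`Q ≡ 1`); Radziwiłł defers "limitations to mollifying `ζ(s)` in the context of Levinson's method" to a sequel that has not appeared [cite: Radziwill2012, p. 4]; (iv) (ii) constrains only the Möbius family `M_N`, uniformly in `N ≤ T^θ` (for arbitrary coefficients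 the twisted-moment asymptotic fails for `θ > 1`, Bettin–Chandee–Radziwiłł loc. cit. p. 2), and is as much a route (moment bounds ⟹ RH) as a wall; (v) for `θ ≥ ½` the constant `c` of (i) is proportional to the (absolute, minute, unprinted) proportion constant of Selberg's theorem, and `c = 1` for `θ < ½` (Prop. B); the qualitative floor `𝓘 ≥ c'/(1+θ)` needs only Prop. A + Lemma 5 (`Radziwill2012_floor_of_propA_lemma5` in `MollifierLimitationsProofs.lean`, whose § "Scope of Theorem 1" records this audit)

[cite: Radziwill2012, Theorem 1] [cite: BettinGonek2017, Theorem 1] -/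
def MollifierLimitations : Prop :=
  Radziwill2012_thm1 ∧ BettinGonek2017_thm1

end Literature.Barriers.RiemannHypothesis
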